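import Summits.AtomisticToContinuum.Crystallization.Theorems.FrustratedLawDichotomyDRowsC15Sound
import Summits.AtomisticToContinuum.Crystallization.Theorems.FrustratedLawDichotomyDRowsBccTemplate

/-!
# DROWS-SOUND for the C15 chunk, piece (s1) I: the C15 template, its separation, and the window/far bookkeeping

decomp-a2c hand-2 g46/g47 — structural share for `AperiodicFrustratedLawGap` (stmt-27623), class-D rows (critic r1757 (C)(b) «DROWS-SOUND»;
census K certificate (234) `…DRowsC15`, read over `ℝ` by `…DRowsC15Sound.drows_C15_sound`).  The C15 (MgCu₂ Laves, Frank–Kasper) template in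
census's integer frame: translations `8ℤ³`, 24-point basis `c15Basis` (census-1 g53 (235); root classes X = `(0,0,0)` and Y = `(5,5,5)`); nearest-neighbour squared frame length `8`, so the template at NN distance `s` is the frame scaled
by `s/√8` (`scaledIntPoint (s/√8)`), ROOTED at a frame point `r` (`c15Template r s` = the frame translated by `−r`, then scaled).

Proved here (symbolic): the basis membership test `inFrame`, its `mod 8` reading; ★ `eight_le_nsq_of_frame` — two distinct frame points are at
squared frame distance `≥ 8` (reduction to the finite check `small_diff_check` over `{−2,…,2}³ × basis²`, `decide`); `c15Template_separated`
(the template at NN distance `s` is `s`-separated); the frame box `[-32,32]³` of the root-centred vectors (`c15Box r`), the window `c15Win r i`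
(census's test `sNum (i+1)²·D < 100·8·sDen²`), `nsq_lt_of_inside_C15` (`⇒ D < 1065`) and `far_of_not_mem_c15Win`.  The kernel counting facts
(COVER/FIBRES per root class) and the composition with `…DRowsAssembly` / `…DRowsRegroup` / `drows_C15_sound` follow in the sequel files.
Reuses `toVec`/`nsq` and their lemmas from `…DRowsBccTemplate`.
-/

namespace Summit.AtomisticToContinuum.Crystallization.Theorems.FrustratedLawDichotomyDRowsC15Template

open MeasureTheory Metric Set
open scoped BigOperators
open Literature.Barriers.AtomisticToContinuum (scaledIntPoint scaledIntPoint_apply norm_scaledIntPoint_sq scaledIntPoint_injective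
  scaledIntPoint_zero)
open Summit.AtomisticToContinuum.Crystallization.Theorems.ChargedEnergyGapNegative (E3)
open Summit.AtomisticToContinuum.Crystallization.Theorems.FrustratedLawDichotomyDRowsC15 (sNum sDen xnum XD)
open Summit.AtomisticToContinuum.Crystallization.Theorems.FrustratedLawDichotomyDRowsBccTemplate
  (toVec nsq toVec_zero toVec_one toVec_two toVec_injective toVec_triple toVec_zero' norm_sq_toVec nsq_nonneg scaledIntPoint_sub)

/-! ## §1 The frame -/

/-- the C15 basis in the integer frame (cell `8ℤ³`): eight class-X sites (Wyckoff `8a`, CN16) and sixteen class-Y sites (`16d`, CN12). -/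
def c15Basis : List (ℤ × ℤ × ℤ) :=
  [(0, 0, 0), (2, 2, 2), (5, 5, 5), (5, 7, 7), (7, 5, 7), (7, 7, 5), (0, 4, 4), (2, 6, 6), (5, 1, 1), (5, 3, 3), (7, 1, 3), (7, 3, 1),
   (4, 0, 4), (6, 2, 6), (1, 5, 1), (1, 7, 3), (3, 5, 3), (3, 7, 1), (4, 4, 0), (6, 6, 2), (1, 1, 5), (1, 3, 7), (3, 1, 7), (3, 3, 5)]

/-- frame membership: `m ∈ 8ℤ³ + c15Basis` (a Boolean test, kernel-friendly). -/
def inFrame (m : ℤ × ℤ × ℤ) : Bool :=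
  c15Basis.any fun b => (m.1 - b.1) % 8 == 0 && (m.2.1 - b.2.1) % 8 == 0 && (m.2.2 - b.2.2) % 8 == 0

/-- **The C15 template at nearest-neighbour distance `s`, rooted at the frame point `r`**: `{(s/√8)·(m − r) : m ∈ frame}`. -/
def c15Template (r : ℤ × ℤ × ℤ) (s : ℝ) : Set E3 :=
  {x | ∃ v : Fin 3 → ℤ, inFrame (v 0 + r.1, v 1 + r.2.1, v 2 + r.2.2) = true ∧ x = scaledIntPoint (s / Real.sqrt 8) v}

/-- the root-centred frame vectors `m − r` in the box `[-32, 32]³`, `m ∈ frame`, `m ≠ r` (every such vector of squared length `< 1065` is in it). -/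
noncomputable def c15Box (r : ℤ × ℤ × ℤ) : Finset (ℤ × ℤ × ℤ) :=
  ((Finset.Icc (-32 : ℤ) 32) ×ˢ ((Finset.Icc (-32 : ℤ) 32) ×ˢ (Finset.Icc (-32 : ℤ) 32))).filter
    fun v => inFrame (v.1 + r.1, v.2.1 + r.2.1, v.2.2 + r.2.2) = true ∧ v ≠ 0

/-- membership in the frame box, read as coordinate bounds. -/
theorem mem_c15Box {r v : ℤ × ℤ × ℤ} :
    v ∈ c15Box r ↔ ((-32 ≤ v.1 ∧ v.1 ≤ 32) ∧ (-32 ≤ v.2.1 ∧ v.2.1 ≤ 32) ∧ (-32 ≤ v.2.2 ∧ v.2.2 ≤ 32)) ∧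
      inFrame (v.1 + r.1, v.2.1 + r.2.1, v.2.2 + r.2.2) = true ∧ v ≠ 0 := by
  unfold c15Box
  rw [Finset.mem_filter, Finset.mem_product, Finset.mem_product, Finset.mem_Icc, Finset.mem_Icc, Finset.mem_Icc]

-- The `65³`-point box is never unfolded by the ELABORATOR after this point: `Meta.whnf` of a membership `v ∈ c15Box r` (as performed e.g. by the
-- `constructorNameAsVariable` linter on every binder) would evaluate the product multiset and exceed the recursion budget; all uses go through
-- `mem_c15Box`.  (An elaborator hint only; the kernel and `decide +kernel` are unaffected.)
attribute [irreducible] c15Box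

/-- the root-centred frame vectors inside the cut of leaf `i` (census's test `sNum (i+1)²·D < 100·4·sDen²` verbatim). -/
noncomputable def c15Win (r : ℤ × ℤ × ℤ) (i : ℕ) : Finset (ℤ × ℤ × ℤ) :=
  (c15Box r).filter fun v => sNum (i + 1) * sNum (i + 1) * nsq v < 100 * (8 * sDen * sDen)

/-- membership in the window of leaf `i`. -/
theorem mem_c15Win {r v : ℤ × ℤ × ℤ} {i : ℕ} :
    v ∈ c15Win r i ↔ v ∈ c15Box r ∧ sNum (i + 1) * sNum (i + 1) * nsq v < 100 * (8 * sDen * sDen) := by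
  unfold c15Win
  rw [Finset.mem_filter]

attribute [irreducible] c15Win

/-- the membership test read in `mod 8` arithmetic. -/
theorem inFrame_iff (m : ℤ × ℤ × ℤ) :
    inFrame m = true ↔ ∃ b ∈ c15Basis, (m.1 - b.1) % 8 = 0 ∧ (m.2.1 - b.2.1) % 8 = 0 ∧ (m.2.2 - b.2.2) % 8 = 0 := by
  simp [inFrame, List.any_eq_true, Bool.and_eq_true, beq_iff_eq, and_assoc]

-- `inFrame` (24 basis points × 3 `mod` tests) is likewise read only through `inFrame_iff` by the elaborator from here on.
attribute [irreducible] inFrame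

/-! ## §2 Separation: distinct frame points are at squared frame distance ≥ 8 -/

/-- the finite check: a vector of `{−2,…,2}³` congruent `mod 8` to a difference of two basis points is `0` or has squared length `≥ 8`. -/
theorem small_diff_check : ∀ b ∈ c15Basis, ∀ b' ∈ c15Basis, ∀ u1 ∈ [(-2 : ℤ), -1, 0, 1, 2], ∀ u2 ∈ [(-2 : ℤ), -1, 0, 1, 2], ∀ u3 ∈ [(-2 : ℤ), -1, 0, 1, 2],
    (u1 - (b.1 - b'.1)) % 8 = 0 → (u2 - (b.2.1 - b'.2.1)) % 8 = 0 → (u3 - (b.2.2 - b'.2.2)) % 8 = 0 →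
      8 ≤ u1 * u1 + u2 * u2 + u3 * u3 ∨ (u1 = 0 ∧ u2 = 0 ∧ u3 = 0) := by
  decide +kernel

/-- an integer of square `≤ 7` lies in `{−2, …, 2}`. -/
theorem mem_small_of_sq_le {a : ℤ} (h : a * a ≤ 7) : a ∈ [(-2 : ℤ), -1, 0, 1, 2] := by
  have h1 : -2 ≤ a := by nlinarith
  have h2 : a ≤ 2 := by nlinarith
  simp only [List.mem_cons, List.mem_nil_iff, or_false]
  omega

/-- ★ two distinct points of the C15 frame are at squared frame distance at least `8`. -/
theorem eight_le_nsq_of_frame {m m' : ℤ × ℤ × ℤ} (hm : inFrame m = true) (hm' : inFrame m' = true) (hne : m ≠ m') :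
    8 ≤ nsq (m.1 - m'.1, m.2.1 - m'.2.1, m.2.2 - m'.2.2) := by
  by_contra hlt
  push Not at hlt
  obtain ⟨b, hb, hb1, hb2, hb3⟩ := (inFrame_iff m).mp hm
  obtain ⟨b', hb', hb1', hb2', hb3'⟩ := (inFrame_iff m').mp hm'
  have hsum : (m.1 - m'.1) * (m.1 - m'.1) + (m.2.1 - m'.2.1) * (m.2.1 - m'.2.1) + (m.2.2 - m'.2.2) * (m.2.2 - m'.2.2) ≤ 7 := by
    unfold nsq at hlt; simpa using Int.lt_add_one_iff.mp hlt
  have hs1 := mem_small_of_sq_le (a := m.1 - m'.1)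
    (by nlinarith [mul_self_nonneg (m.2.1 - m'.2.1), mul_self_nonneg (m.2.2 - m'.2.2)])
  have hs2 := mem_small_of_sq_le (a := m.2.1 - m'.2.1)
    (by nlinarith [mul_self_nonneg (m.1 - m'.1), mul_self_nonneg (m.2.2 - m'.2.2)])
  have hs3 := mem_small_of_sq_le (a := m.2.2 - m'.2.2)
    (by nlinarith [mul_self_nonneg (m.1 - m'.1), mul_self_nonneg (m.2.1 - m'.2.1)])
  rcases small_diff_check b hb b' hb' _ hs1 _ hs2 _ hs3 (by omega) (by omega) (by omega) with h | h
  · exact absurd hsum (not_le.mpr (Int.lt_of_lt_of_le (by norm_num) h))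
  · exact hne (Prod.ext (by omega) (Prod.ext (by omega) (by omega)))

/-- ★ the C15 template at NN distance `s > 0` (any root) is `s`-separated. -/
theorem c15Template_separated (r : ℤ × ℤ × ℤ) {s : ℝ} (hs : 0 < s) :
    ∀ p ∈ c15Template r s, ∀ p' ∈ c15Template r s, p ≠ p' → s ≤ dist p p' := by
  rintro p ⟨v, hv, rfl⟩ p' ⟨w, hw, rfl⟩ hne
  rw [dist_eq_norm, scaledIntPoint_sub]
  have hne' : (v 0 + r.1, v 1 + r.2.1, v 2 + r.2.2) ≠ (w 0 + r.1, w 1 + r.2.1, w 2 + r.2.2) := by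
    intro h
    simp only [Prod.mk.injEq] at h
    apply hne
    have : v = w := by
      funext j; fin_cases j
      · simpa using h.1
      · simpa using h.2.1
      · simpa using h.2.2
    rw [this]
  have h4 := eight_le_nsq_of_frame hv hw hne'
  have h4' : (8 : ℤ) ≤ (v 0 - w 0) * (v 0 - w 0) + (v 1 - w 1) * (v 1 - w 1) + (v 2 - w 2) * (v 2 - w 2) := by
    unfold nsq at h4; simpa using h4
  have hsq : s ^ 2 ≤ ‖scaledIntPoint (s / Real.sqrt 8) (v - w)‖ ^ 2 := by
    rw [norm_scaledIntPoint_sq, Fin.sum_univ_three, div_pow, Real.sq_sqrt (by norm_num : (0 : ℝ) ≤ 8)]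
    simp only [Pi.sub_apply, Int.cast_sub]
    have : (8 : ℝ) ≤ ((v 0 : ℝ) - w 0) ^ 2 + ((v 1 : ℝ) - w 1) ^ 2 + ((v 2 : ℝ) - w 2) ^ 2 := by
      have := (Int.cast_le (R := ℝ)).mpr h4'
      push_cast at this; nlinarith
    nlinarith [sq_nonneg s]
  exact (pow_le_pow_iff_left₀ hs.le (norm_nonneg _) two_ne_zero).mp hsq

/-- the root belongs to its template when it is a frame point. -/
theorem zero_mem_c15Template {r : ℤ × ℤ × ℤ} (hr : inFrame r = true) (s : ℝ) : (0 : E3) ∈ c15Template r s :=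
  ⟨0, by simpa using hr, (scaledIntPoint_zero _).symm⟩

/-! ## §3 Arithmetic of the C15 scale window -/

/-- the common denominator of the C15 scale is positive (file-local). -/
private theorem sDen_pos : 0 < sDen := by unfold sDen XD; decide

/-- `sDen = 1.28·10⁹` (file-local: the printed statement coincides with the bcc twin's). -/
private theorem sDen_eq_C15 : sDen = 1280000000 := by unfold sDen XD; norm_num

/-- the upper end of every C15 leaf is at least `sNum 1 = 92206·12044`. -/
theorem sNum_succ_ge_C15 (i : ℕ) : 1110529064 ≤ sNum (i + 1) := by unfold sNum xnum; push_cast; omega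

/-- a shell inside the cut of any C15 leaf has squared frame length `< 1065`. -/
theorem nsq_lt_of_inside_C15 {i : ℕ} {D : ℤ} (hD : sNum (i + 1) * sNum (i + 1) * D < 100 * (8 * sDen * sDen)) : D < 1065 := by
  rcases lt_or_ge D 1065 with hlt | hge
  · exact hlt
  exfalso
  have h1 := sNum_succ_ge_C15 i
  have h0 : (0 : ℤ) ≤ sNum (i + 1) := by linarith
  have h2 : (1110529064 : ℤ) * 1110529064 ≤ sNum (i + 1) * sNum (i + 1) := mul_le_mul h1 h1 (by norm_num) h0
  have h3 : sNum (i + 1) * sNum (i + 1) * 1065 ≤ sNum (i + 1) * sNum (i + 1) * D := mul_le_mul_of_nonneg_left hge (mul_nonneg h0 h0)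
  rw [sDen_eq_C15] at hD
  linarith

/-- a root-centred frame vector NOT inside the cut satisfies `100·8·sDen² ≤ sNum(i+1)²·nsq v` (failed test inside the box, or a coordinate `≥ 33`). -/
theorem far_of_not_mem_c15Win {r : ℤ × ℤ × ℤ} {i : ℕ} {v : ℤ × ℤ × ℤ} (hfr : inFrame (v.1 + r.1, v.2.1 + r.2.1, v.2.2 + r.2.2) = true)
    (hv0 : v ≠ 0) (hw : v ∉ c15Win r i) : 100 * (8 * sDen * sDen) ≤ sNum (i + 1) * sNum (i + 1) * nsq v := by
  rcases lt_or_ge (sNum (i + 1) * sNum (i + 1) * nsq v) (100 * (8 * sDen * sDen)) with hlt | hge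
  · exfalso
    rcases em ((-32 ≤ v.1 ∧ v.1 ≤ 32) ∧ (-32 ≤ v.2.1 ∧ v.2.1 ≤ 32) ∧ (-32 ≤ v.2.2 ∧ v.2.2 ≤ 32)) with hc | hnot
    · exact hw (mem_c15Win.mpr ⟨mem_c15Box.mpr ⟨hc, hfr, hv0⟩, hlt⟩)
    · simp only [not_and_or, not_le] at hnot
      have h1089 : 1089 ≤ nsq v := by
        unfold nsq
        rcases hnot with (h | h) | (h | h) | (h | h) <;>
          nlinarith [mul_self_nonneg v.1, mul_self_nonneg v.2.1, mul_self_nonneg v.2.2]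
      have h1 := sNum_succ_ge_C15 i
      have h0 : (0 : ℤ) ≤ sNum (i + 1) := by linarith
      have h2 : (1110529064 : ℤ) * 1110529064 ≤ sNum (i + 1) * sNum (i + 1) := mul_le_mul h1 h1 (by norm_num) h0
      have h3 : sNum (i + 1) * sNum (i + 1) * 1089 ≤ sNum (i + 1) * sNum (i + 1) * nsq v :=
        mul_le_mul_of_nonneg_left h1089 (mul_nonneg h0 h0)
      rw [sDen_eq_C15] at hlt
      linarith
  · exact hge

end Summit.AtomisticToContinuum.Crystallization.Theorems.FrustratedLawDichotomyDRowsC15Template
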